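import Summits.BirchSwinnertonDyer.BirchSwinnertonDyer.Theorems.BiquadraticEisensteinDescentSymbolicMonskyDefs
import Mathlib.LinearAlgebra.Span.Defs
import HarnessLib

set_option linter.dupNamespace false -- `Summit.BirchSwinnertonDyer.BirchSwinnertonDyer.Theorems.…` (summit = sub)
set_option autoImplicit false

/-!
# Route `BiquadraticEisensteinDescent` — DEFINITIONS (D-0017 `Theorems/<RouteSlug><Topic>Defs.lean`, reviewed): the VIRTUAL KERNEL of a symbol
# datum as an `𝔽₂`-subspace of `V ⊕ V` (crux `HeegnerTwistCouplingInSupply`, stmt-BirchSwinnertonDyer-21381, corner layer)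

Cell `pub/bsd-wall`, width-prover seat `bsd-wall-cm-bed-w3` g22 (explicit-unit). For a symbol datum `d : SymbData b` (primes `P₀ … P_{b−1}` with
classes and symbols; `N(i,j) = [(P_j/P_i) = −1]`, `m_i = [P_i ≡ 3 (4)]`, `d_i = [(2/P_i) = −1]`, `L` the Laplacian `(Lx)_i = Σ_j N(i,j)(x_j + x_i)`),
the VIRTUAL KERNEL is the set of pairs `(x, y) ∈ 𝔽₂^b × 𝔽₂^b` with `(L + D_m) x + D_d y = 0` and `D_m x + L y = 0` — the base block of the kernel
of Monsky's matrix of the virtual twist `n₀ℓ*` (memo PATTERN-FREE-MECHANISM-w3g20 §3; its dimension is `s* − 1`). These equations are exactly the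
hypotheses `hE1`/`hE2` of `…SymbolicMonskyLeftKernel`, `…TwoPrime`, `…Design`. Here they are packaged as a `Submodule (ZMod 2)` so that the
dimension statements of the uniform existence theorem (`…SymbolicMonskyDesignExists`: `finrank`, intersections with `V × 0`, `0 × V`, the diagonal)
can be SAID with Mathlib's linear algebra.

* `SymbData.virtualKernel d : Submodule (ZMod 2) ((Fin b → ZMod 2) × (Fin b → ZMod 2))` (carrier = the pairs above; closure under `+`, `0`, `•` proved);
* `SymbData.augKernel d δ := d.virtualKernel ⊔ span {(δ, 1)}` — the augmented kernel `𝒦⁺ = 𝒦 + ⟨(δ, 1)⟩` of a design with `(2/·)`-vector `δ`.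

DEFINITIONS ONLY (two `def`s with the closure proofs they need); no theorem, no named fact, no `sorry`, no instance, no notation. Nothing here asserts
anything about Selmer groups, `L`-values, the crux or BSD.
Reference: [HeathBrown1994] D. R. Heath-Brown, Invent. Math. 118 (1994) 331–370, appendix by P. Monsky (typescript pp. 39–41).
-/

namespace Summit.BirchSwinnertonDyer.BirchSwinnertonDyer.Theorems.SymbolicMonsky

namespace SymbData

variable {b : ℕ} (d : SymbData b)

/-- The VIRTUAL KERNEL of a symbol datum: pairs `(x, y)` of `𝔽₂`-vectors on the index set with `(L + D_m)x + D_d y = 0` and `D_m x + L y = 0`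
(coordinates: `Σ_j bz(neg i j)(x_j + x_i) + bz[P_i ≡ 3 (4)] x_i + bz[(2/P_i) = −1] y_i = 0` and `bz[P_i ≡ 3 (4)] x_i + Σ_j bz(neg i j)(y_j + y_i) = 0`
for every `i`), as a subspace of `V × V`, `V = Fin b → ZMod 2`. [folklore] -/
def virtualKernel : Submodule (ZMod 2) ((Fin b → ZMod 2) × (Fin b → ZMod 2)) where
  carrier := {p | (∀ i, (∑ j, bz (d.neg i j) * (p.1 j + p.1 i)) + bz (negNegOne (d.cls i)) * p.1 i + bz (negTwo (d.cls i)) * p.2 i = 0) ∧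
    (∀ i, bz (negNegOne (d.cls i)) * p.1 i + ∑ j, bz (d.neg i j) * (p.2 j + p.2 i) = 0)}
  add_mem' := by
    intro p q hp hq
    refine ⟨fun i => ?_, fun i => ?_⟩
    · have h1 := hp.1 i
      have h2 := hq.1 i
      simp only [Prod.fst_add, Prod.snd_add, Pi.add_apply]
      have e : (∑ j, bz (d.neg i j) * ((p.1 j + q.1 j) + (p.1 i + q.1 i))) =
          (∑ j, bz (d.neg i j) * (p.1 j + p.1 i)) + ∑ j, bz (d.neg i j) * (q.1 j + q.1 i) := by
        rw [← Finset.sum_add_distrib]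
        exact Finset.sum_congr rfl fun j _ => by ring
      rw [e]
      linear_combination h1 + h2
    · have h1 := hp.2 i
      have h2 := hq.2 i
      simp only [Prod.fst_add, Prod.snd_add, Pi.add_apply]
      have e : (∑ j, bz (d.neg i j) * ((p.2 j + q.2 j) + (p.2 i + q.2 i))) =
          (∑ j, bz (d.neg i j) * (p.2 j + p.2 i)) + ∑ j, bz (d.neg i j) * (q.2 j + q.2 i) := by
        rw [← Finset.sum_add_distrib]
        exact Finset.sum_congr rfl fun j _ => by ring
      rw [e]
      linear_combination h1 + h2
  zero_mem' := by
    refine ⟨fun i => ?_, fun i => ?_⟩ <;> simp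
  smul_mem' := by
    intro c p hp
    refine ⟨fun i => ?_, fun i => ?_⟩
    · have h1 := hp.1 i
      simp only [Prod.smul_fst, Prod.smul_snd, Pi.smul_apply, smul_eq_mul]
      have e : (∑ j, bz (d.neg i j) * (c * p.1 j + c * p.1 i)) = c * ∑ j, bz (d.neg i j) * (p.1 j + p.1 i) := by
        rw [Finset.mul_sum]
        exact Finset.sum_congr rfl fun j _ => by ring
      rw [e]
      linear_combination c * h1
    · have h2 := hp.2 i
      simp only [Prod.smul_fst, Prod.smul_snd, Pi.smul_apply, smul_eq_mul]
      have e : (∑ j, bz (d.neg i j) * (c * p.2 j + c * p.2 i)) = c * ∑ j, bz (d.neg i j) * (p.2 j + p.2 i) := by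
        rw [Finset.mul_sum]
        exact Finset.sum_congr rfl fun j _ => by ring
      rw [e]
      linear_combination c * h2

/-- The AUGMENTED KERNEL of a design with `(2/·)`-vector `δ`: `𝒦⁺ = 𝒦 + ⟨(δ, 1)⟩` (`1` = the all-ones vector). [folklore] -/
def augKernel (δ : Fin b → ZMod 2) : Submodule (ZMod 2) ((Fin b → ZMod 2) × (Fin b → ZMod 2)) :=
  d.virtualKernel ⊔ Submodule.span (ZMod 2) {(δ, fun _ => 1)}

end SymbData

end Summit.BirchSwinnertonDyer.BirchSwinnertonDyer.Theorems.SymbolicMonsky
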